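import Mathlib.Analysis.Calculus.UniformLimitsDeriv
import Mathlib.Topology.Algebra.InfiniteSum.Real
import Mathlib.Analysis.Normed.Group.InfiniteSum
import HarnessLib

/-!
# Venture YMGap, track ROBUST-BALL (Y2) — tool file (pure analysis): the derivative of a limit of functions whose derivatives are
# TRUNCATED SUMS with a summable majorant

HONEST FRAMING. WHAT THIS IS: a venture file (cell `pub-ymgap`, track Y2 ROBUST-BALL, seat rb-p1, theorems only) with no lattice content —
the real-analysis step of `StateDerivativeOnBallS.lean` (there: `f n s = ⟨F⟩_{W + s·𝟙_{T_n}V}`, `c n s X = cov(F, V_X)` in that state).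
* `tendstoUniformlyOn_finsetSum_tsum` — if `T n → atTop` in `Finset ι` (an exhausting sequence of finite index sets), the terms `c n s X` and
  `c∞ s X` are dominated by ONE summable `Φ X ≥ 0` uniformly in `s ∈ I`, and `c n · X → c∞ · X` uniformly on `I` for each fixed `X`, then
  `Σ_{X ∈ T n} c n s X → Σ'_X c∞ s X` uniformly on `I` (tail of the majorant + finitely many uniformly convergent terms);
* `hasDerivAt_of_truncations` — if moreover each `f n` has derivative `−Σ_{X ∈ T n} c n s X` on the open set `I` and `f n → f∞` pointwise
  on `I`, then `f∞` has derivative `−Σ'_X c∞ s X` at every point of `I` (Mathlib `hasDerivAt_of_tendstoUniformlyOn`).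
WHAT THIS IS NOT: anything about lattice gauge theory; a standard uniform-limits-of-derivatives argument recorded once for the lane.
-/

noncomputable section

open Filter Topology Finset

namespace Summit.Ventures.YMGap.RobustBall

/-- **Uniform convergence of truncated sums under a summable majorant.**  If `T n` tends to `atTop` in `Finset ι` (exhausts the index
type), the terms `c n s X` and their limits `c∞ s X` are dominated by a summable `Φ X ≥ 0` uniformly in `s ∈ I`, and for each fixed `X`,
`c n · X → c∞ · X` uniformly on `I`, then `Σ_{X ∈ T n} c n s X → Σ'_X c∞ s X` uniformly on `I`. -/
theorem tendstoUniformlyOn_finsetSum_tsum {ι : Type*} {T : ℕ → Finset ι} (hT : Tendsto T atTop atTop)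
    {Φ : ι → ℝ} (hΦ0 : ∀ X, 0 ≤ Φ X) (hΦ : Summable Φ) {I : Set ℝ} {c : ℕ → ℝ → ι → ℝ} {cinf : ℝ → ι → ℝ}
    (hc : ∀ n, ∀ s ∈ I, ∀ X, |c n s X| ≤ Φ X) (hcinf : ∀ s ∈ I, ∀ X, |cinf s X| ≤ Φ X)
    (hconv : ∀ X, TendstoUniformlyOn (fun n s => c n s X) (fun s => cinf s X) atTop I) :
    TendstoUniformlyOn (fun n s => ∑ X ∈ T n, c n s X) (fun s => ∑' X, cinf s X) atTop I := by
  classical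
  rw [Metric.tendstoUniformlyOn_iff]
  intro ε hε
  -- a finite set carrying all but `ε/4` of the majorant
  have htail : ∀ᶠ K : Finset ι in atTop, ∑' X : {X // X ∉ K}, Φ X < ε / 4 :=
    (tendsto_tsum_compl_atTop_zero Φ).eventually (eventually_lt_nhds (by linarith))
  obtain ⟨K, hK⟩ := htail.exists
  -- eventually `K ⊆ T n`
  have hKT : ∀ᶠ n in atTop, K ⊆ T n := by
    have := hT.eventually (eventually_ge_atTop K)
    exact this
  -- eventually every term of `K` is `ε/(2(#K+1))`-close, uniformly on `I`
  have hKpos : (0 : ℝ) < 2 * (K.card + 1) := by positivity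
  have hnear : ∀ᶠ n in atTop, ∀ X ∈ K, ∀ s ∈ I, |cinf s X - c n s X| < ε / (2 * (K.card + 1)) := by
    refine (Finset.eventually_all K).2 fun X _ => ?_
    have h := (Metric.tendstoUniformlyOn_iff.1 (hconv X)) (ε / (2 * (K.card + 1))) (by positivity)
    filter_upwards [h] with n hn s hs
    have := hn s hs
    rwa [Real.dist_eq] at this
  filter_upwards [hKT, hnear] with n hKn hn s hs
  rw [Real.dist_eq]
  -- summability of the limit terms at `s`
  have hsum_inf : Summable fun X => cinf s X :=
    hΦ.of_norm_bounded fun X => by rw [Real.norm_eq_abs]; exact hcinf s hs X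
  -- split both sums along `K`
  have hsplit_inf : ∑' X, cinf s X = ∑ X ∈ K, cinf s X + ∑' X : {X // X ∉ K}, cinf s X :=
    (hsum_inf.sum_add_tsum_subtype_compl K).symm
  have hsplit_n : ∑ X ∈ T n, c n s X = ∑ X ∈ K, c n s X + ∑ X ∈ T n \ K, c n s X := by
    rw [← Finset.sum_sdiff hKn, add_comm]
  -- the three error terms
  have h1 : |∑ X ∈ K, cinf s X - ∑ X ∈ K, c n s X| ≤ K.card * (ε / (2 * (K.card + 1))) := by
    rw [← Finset.sum_sub_distrib]
    refine (Finset.abs_sum_le_sum_abs _ _).trans ?_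
    calc ∑ X ∈ K, |cinf s X - c n s X| ≤ ∑ _X ∈ K, ε / (2 * (K.card + 1)) :=
          Finset.sum_le_sum fun X hX => (hn X hX s hs).le
      _ = K.card * (ε / (2 * (K.card + 1))) := by rw [Finset.sum_const, nsmul_eq_mul]
  have h2 : |∑ X ∈ T n \ K, c n s X| ≤ ∑' X : {X // X ∉ K}, Φ X := by
    refine (Finset.abs_sum_le_sum_abs _ _).trans ?_
    refine (Finset.sum_le_sum fun X _ => hc n s hs X).trans ?_
    -- `Σ_{T n \ K} Φ ≤ Σ'_{∉ K} Φ`: compare `Σ_{T n} Φ ≤ Σ' Φ` with the two splittings along `K`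
    have hA : ∑ X ∈ T n, Φ X ≤ ∑' X, Φ X := hΦ.sum_le_tsum _ fun X _ => hΦ0 X
    have hB : ∑ X ∈ T n, Φ X = ∑ X ∈ K, Φ X + ∑ X ∈ T n \ K, Φ X := by rw [← Finset.sum_sdiff hKn, add_comm]
    have hC := hΦ.sum_add_tsum_subtype_compl K
    linarith
  have h3 : |∑' X : {X // X ∉ K}, cinf s X| ≤ ∑' X : {X // X ∉ K}, Φ X := by
    have hs1 : Summable fun X : {X // X ∉ K} => ‖cinf s X‖ :=
      ((hsum_inf.subtype fun X => X ∉ K).abs).congr fun X => by simp only [Function.comp_apply, Real.norm_eq_abs]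
    refine (Real.norm_eq_abs _ ▸ norm_tsum_le_tsum_norm hs1).trans ?_
    exact hs1.tsum_le_tsum (fun X => by rw [Real.norm_eq_abs]; exact hcinf s hs X) (hΦ.subtype _)
  have hKε : K.card * (ε / (2 * (K.card + 1))) ≤ ε / 2 := by
    rw [← mul_div_assoc, div_le_div_iff₀ hKpos (by norm_num : (0 : ℝ) < 2)]
    have hK0 : (0 : ℝ) ≤ K.card := Nat.cast_nonneg _
    nlinarith
  calc |∑' X, cinf s X - ∑ X ∈ T n, c n s X|
      = |(∑ X ∈ K, cinf s X - ∑ X ∈ K, c n s X) + ∑' X : {X // X ∉ K}, cinf s X - ∑ X ∈ T n \ K, c n s X| := by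
        rw [hsplit_inf, hsplit_n]; ring_nf
    _ ≤ |∑ X ∈ K, cinf s X - ∑ X ∈ K, c n s X| + |∑' X : {X // X ∉ K}, cinf s X| + |∑ X ∈ T n \ K, c n s X| := by
        set A := ∑ X ∈ K, cinf s X - ∑ X ∈ K, c n s X
        set B := ∑' X : {X // X ∉ K}, cinf s X
        set C := ∑ X ∈ T n \ K, c n s X
        have hAB : |A + B - C| ≤ |A + B| + |C| := abs_sub (A + B) C
        have hAB' : |A + B| ≤ |A| + |B| := abs_add_le A B
        linarith
    _ < ε := by linarith

/-- **The derivative of the limit from the truncations** (Mathlib `hasDerivAt_of_tendstoUniformlyOn` + the previous lemma): if each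
`f n` has derivative `−Σ_{X ∈ T n} c n s X` on the open set `I`, `f n → f∞` pointwise on `I`, and the hypotheses of
`tendstoUniformlyOn_finsetSum_tsum` hold, then `f∞` has derivative `−Σ'_X c∞ s X` at every `s ∈ I`. -/
theorem hasDerivAt_of_truncations {ι : Type*} {T : ℕ → Finset ι} (hT : Tendsto T atTop atTop)
    {Φ : ι → ℝ} (hΦ0 : ∀ X, 0 ≤ Φ X) (hΦ : Summable Φ) {I : Set ℝ} (hI : IsOpen I)
    {c : ℕ → ℝ → ι → ℝ} {cinf : ℝ → ι → ℝ}
    (hc : ∀ n, ∀ s ∈ I, ∀ X, |c n s X| ≤ Φ X) (hcinf : ∀ s ∈ I, ∀ X, |cinf s X| ≤ Φ X)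
    (hconv : ∀ X, TendstoUniformlyOn (fun n s => c n s X) (fun s => cinf s X) atTop I)
    {f : ℕ → ℝ → ℝ} {finf : ℝ → ℝ} (hderiv : ∀ n, ∀ s ∈ I, HasDerivAt (f n) (-(∑ X ∈ T n, c n s X)) s)
    (hlim : ∀ s ∈ I, Tendsto (fun n => f n s) atTop (𝓝 (finf s))) {s₀ : ℝ} (hs₀ : s₀ ∈ I) :
    HasDerivAt finf (-(∑' X, cinf s₀ X)) s₀ :=
  hasDerivAt_of_tendstoUniformlyOn hI ((tendstoUniformlyOn_finsetSum_tsum hT hΦ0 hΦ hc hcinf hconv).neg)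
    (Eventually.of_forall hderiv) hlim hs₀

end Summit.Ventures.YMGap.RobustBall

end
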